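import Literature.AlgebraicGeometry.Resolution.SharpMonoidEmbedding
import HarnessLib

/-!
# Crux `FrobeniusLadder.FRationalResolution` (stmt-ResolutionOfSingularities-15317), line `redirect`,
# stub `stub_diagonalizableQuotientResolution` — **normal form of a sharp rank-two fs monoid** (brick C1a of
# memo MEMO-15317-leafhand2-g7/g8: the INPUT of the Hirzebruch–Jung chain `…ConeChain.chain_exists` /
# `…ConeChainCharts.round_charts` at round 0 of the point-blow-up recursion for the surface case)

Lattice geometry in `ℤ²`. **`exists_normalForm`**: a finitely generated, saturated, spanning, SHARP submonoid
`P ⊆ ℤ²` (the chart monoid at a singular point of a surface with unit face `0`, `…IsolatedQuotientResolution.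
exists_sharp_affine_chart`) is, in a suitable `ℤ`-basis `(u, e)` of `ℤ²`, the cone in normal form

  `P = {m u + l e : l ≥ 0, a l ≤ d m}`, `0 ≤ a < d`.

Proof: Gordan/Farkas in the tree's form `LogChart.exists_embedding_of_sharp` gives an injective additive
`E : ℤ² → ℤ²` with `E(P) ⊆ ℕ²`, hence a functional `λ = E₀ + E₁` positive on `P ∖ 0` and the alternating
form `D(p, q) = E₀(q)E₁(p) − E₁(q)E₀(p)`; the generators of maximal / minimal slope `E₁/λ` are the extremal
rays `u`, `u'` (`D(u, ·) ≥ 0 ≤ D(·, u')` on `P`), saturation gives `P = {D(u, ·) ≥ 0} ∩ {D(·, u') ≥ 0}`, and a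
Bézout basis `(u, e)` through the primitive vector `u`, shifted along `u`, puts this in normal form.

* `cross_smul`, `basis_of_cross_eq_one`, `exists_primitive` — `ℤ²` bookkeeping (Bézout);
* `cross_map_single_ne_zero`, `eq_zero_of_forall_cross_map` — non-degeneracy of `D` for injective `E`;
* **`exists_normalForm`**.

Honest label: combinatorics toward ONE leaf stub (no stub, crux or summit closed). No definitions, no named
facts, no sorry. [cite: Fulton1993Toric, §1.2, §2.2] [cite: KempfEtAl1973, Ch. I §2] [cite: Kato1994, (10.1)]
-/

-- single-problem summit: the doubled namespace component is forced
set_option linter.dupNamespace false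

open Literature.AlgebraicGeometry.Resolution

namespace Summit.ResolutionOfSingularities.ResolutionOfSingularities.Theorems.FRationalResolution.ConeNormalForm

/-! ### `ℤ²` bookkeeping -/

/-- The plane vector identity `cr(p,q)·w = cr(w,q)·p + cr(p,w)·q`. [folklore] -/
theorem cross_smul (p q w : Fin 2 → ℤ) :
    (p 0 * q 1 - p 1 * q 0) • w = (w 0 * q 1 - w 1 * q 0) • p + (p 0 * w 1 - p 1 * w 0) • q := by
  funext i; fin_cases i <;> simp <;> ring

/-- A pair `(u, e)` with `cr(u, e) = 1` is a `ℤ`-basis of `ℤ²`. [folklore] -/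
theorem basis_of_cross_eq_one {u e : Fin 2 → ℤ} (h : u 0 * e 1 - u 1 * e 0 = 1) :
    (∀ m l : ℤ, m • u + l • e = 0 → m = 0 ∧ l = 0) ∧ (∀ w : Fin 2 → ℤ, ∃ m l : ℤ, w = m • u + l • e) := by
  refine ⟨fun m l hml => ?_, fun w => ⟨w 0 * e 1 - w 1 * e 0, u 0 * w 1 - u 1 * w 0, ?_⟩⟩
  · have h0 := congr_fun hml 0
    have h1 := congr_fun hml 1
    simp only [Pi.add_apply, Pi.smul_apply, smul_eq_mul, Pi.zero_apply] at h0 h1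
    constructor
    · linear_combination (e 1) * h0 - (e 0) * h1 - m * h
    · linear_combination (u 0) * h1 - (u 1) * h0 - l * h
  · have := cross_smul u e w
    rw [h, one_smul] at this
    exact this

/-- A non-zero vector of `ℤ²` is a positive multiple of a primitive one, which extends to a basis (Bézout).
[folklore] -/
theorem exists_primitive {u : Fin 2 → ℤ} (hu : u ≠ 0) :
    ∃ (g : ℕ) (u₁ e : Fin 2 → ℤ), 0 < g ∧ u = (g : ℤ) • u₁ ∧ u₁ 0 * e 1 - u₁ 1 * e 0 = 1 := by
  have hg : 0 < Int.gcd (u 0) (u 1) := by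
    rw [pos_iff_ne_zero, Ne, Int.gcd_eq_zero_iff]
    rintro ⟨h0, h1⟩
    exact hu (by funext i; fin_cases i <;> simp [h0, h1])
  set g := Int.gcd (u 0) (u 1) with hgdef
  have hd0 : (g : ℤ) ∣ u 0 := Int.gcd_dvd_left (u 0) (u 1)
  have hd1 : (g : ℤ) ∣ u 1 := Int.gcd_dvd_right (u 0) (u 1)
  have hbez := Int.gcd_eq_gcd_ab (u 0 / g) (u 1 / g)
  rw [Int.gcd_div_gcd_div_gcd hg, Nat.cast_one] at hbez
  refine ⟨g, ![u 0 / g, u 1 / g], ![-Int.gcdB (u 0 / g) (u 1 / g), Int.gcdA (u 0 / g) (u 1 / g)], hg, ?_, ?_⟩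
  · funext i; fin_cases i
    · simp [Int.mul_ediv_cancel' hd0]
    · simp [Int.mul_ediv_cancel' hd1]
  · simp only [Matrix.cons_val_zero, Matrix.cons_val_one]
    linear_combination -hbez

/-! ### Non-degeneracy of the alternating form of an injective endomorphism -/

/-- For an injective additive `E : ℤ² → ℤ²` the images of the two basis vectors are not parallel. [folklore] -/
theorem cross_map_single_ne_zero (E : (Fin 2 → ℤ) →+ (Fin 2 → ℤ)) (hE : Function.Injective E) :
    E (Pi.single 0 1) 0 * E (Pi.single 1 1) 1 - E (Pi.single 0 1) 1 * E (Pi.single 1 1) 0 ≠ 0 := by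
  intro h
  set p := E (Pi.single 0 1) with hp
  set q := E (Pi.single 1 1) with hq
  -- `q i • e₀ − p i • e₁ ∈ ker E` for `i = 0, 1`
  have hk : ∀ i : Fin 2, (q i • (Pi.single 0 1 : Fin 2 → ℤ) - p i • (Pi.single 1 1 : Fin 2 → ℤ)) = 0 := by
    intro i
    apply hE
    rw [map_zero, map_sub, map_zsmul, map_zsmul, ← hp, ← hq]
    funext j
    fin_cases i <;> fin_cases j <;> simp <;> first | ring1 | linear_combination h | linear_combination (-1 : ℤ) * h
  have hq0 : q 0 = 0 := by simpa using congr_fun (hk 0) 0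
  have hp0 : p 0 = 0 := by simpa using congr_fun (hk 0) 1
  have hq1 : q 1 = 0 := by simpa using congr_fun (hk 1) 0
  have hp1 : p 1 = 0 := by simpa using congr_fun (hk 1) 1
  have hp' : p = 0 := by funext j; fin_cases j <;> simp [hp0, hp1]
  have : (Pi.single 0 1 : Fin 2 → ℤ) = 0 := hE (by rw [map_zero, ← hp, hp'])
  simpa using congr_fun this 0

/-- If `D(u, x) = cr(E x, E u)` vanishes for all `x` then `u = 0` (`E` injective). [folklore] -/
theorem eq_zero_of_forall_cross_map (E : (Fin 2 → ℤ) →+ (Fin 2 → ℤ)) (hE : Function.Injective E)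
    {u : Fin 2 → ℤ} (h : ∀ x : Fin 2 → ℤ, E x 0 * E u 1 - E x 1 * E u 0 = 0) : u = 0 := by
  have key := cross_smul (E (Pi.single 0 1)) (E (Pi.single 1 1)) (E u)
  have h0 := h (Pi.single 0 1)
  have h1 := h (Pi.single 1 1)
  have e1 : E u 0 * E (Pi.single 1 1) 1 - E u 1 * E (Pi.single 1 1) 0 = 0 := by linear_combination -h1
  rw [e1, h0, zero_smul, zero_smul, add_zero] at key
  have hEu : E u = 0 := by
    rcases smul_eq_zero.1 key with hc | hc
    · exact absurd hc (cross_map_single_ne_zero E hE)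
    · exact hc
  exact hE (by rw [hEu, map_zero])

/-! ### The normal form -/

/-- **Normal form of a sharp rank-two fs monoid.** A finitely generated, saturated, spanning, sharp
`P ⊆ ℤ²` is `{m u + l e : l ≥ 0, a l ≤ d m}` for a `ℤ`-basis `(u, e)` of `ℤ²` and integers `0 ≤ a < d`.
[cite: Fulton1993Toric, §2.2] [cite: KempfEtAl1973, Ch. I §2] -/
theorem exists_normalForm (P : AddSubmonoid (Fin 2 → ℤ)) (hP : P.FG)
    (hsat : ∀ (w : Fin 2 → ℤ) (k : ℕ), 0 < k → k • w ∈ P → w ∈ P)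
    (hspan : Submodule.span ℤ (P : Set (Fin 2 → ℤ)) = ⊤) (hsharp : ∀ p ∈ P, -p ∈ P → p = 0) :
    ∃ (u e : Fin 2 → ℤ) (d a : ℕ), a < d ∧ (∀ m l : ℤ, m • u + l • e = 0 → m = 0 ∧ l = 0) ∧
      (∀ w : Fin 2 → ℤ, ∃ m l : ℤ, w = m • u + l • e) ∧
      ∀ w, w ∈ P ↔ ∃ m l : ℤ, 0 ≤ l ∧ (a : ℤ) * l ≤ (d : ℤ) * m ∧ w = m • u + l • e := by
  classical
  -- generators
  obtain ⟨T, hT⟩ := hP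
  let v : Fin T.card → (Fin 2 → ℤ) := fun i => ((T.equivFin.symm i : T) : Fin 2 → ℤ)
  have hrange : AddSubmonoid.closure (Set.range v) = P := by
    rw [← hT]; congr 1; ext x
    constructor
    · rintro ⟨i, rfl⟩; exact (T.equivFin.symm i).2
    · intro hx; exact ⟨T.equivFin ⟨x, hx⟩, by simp [v]⟩
  have hTP : ∀ g ∈ T, g ∈ P := fun g hg => hT ▸ AddSubmonoid.subset_closure hg
  -- the embedding `E : ℤ² → ℤ²`, `E(P) ⊆ ℕ²`
  obtain ⟨E, hEinj, hEpos⟩ := LogChart.exists_embedding_of_sharp v (by rw [hrange]; exact hsharp)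
  rw [hrange] at hEpos
  -- `λ = E₀ + E₁ > 0` on `P ∖ 0`
  have hlam : ∀ p ∈ P, p ≠ 0 → 0 < E p 0 + E p 1 := by
    intro p hp hp0
    have h0 := hEpos p hp 0
    have h1 := hEpos p hp 1
    rcases (add_nonneg h0 h1).lt_or_eq with h | h
    · exact h
    · exfalso
      apply hp0
      apply hEinj
      rw [map_zero]
      funext i; fin_cases i
      · show E p 0 = 0; omega
      · show E p 1 = 0; omega
  -- `D(p, q) = E q 0 * E p 1 − E q 1 * E p 0`, additive in each slot
  have hDadd : ∀ p q r : Fin 2 → ℤ, E (q + r) 0 * E p 1 - E (q + r) 1 * E p 0 =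
      (E q 0 * E p 1 - E q 1 * E p 0) + (E r 0 * E p 1 - E r 1 * E p 0) := by
    intro p q r; rw [map_add]; simp only [Pi.add_apply]; ring
  have hDadd' : ∀ p q r : Fin 2 → ℤ, E p 0 * E (q + r) 1 - E p 1 * E (q + r) 0 =
      (E p 0 * E q 1 - E p 1 * E q 0) + (E p 0 * E r 1 - E p 1 * E r 0) := by
    intro p q r; rw [map_add]; simp only [Pi.add_apply]; ring
  -- three-term identity
  have h3 : ∀ p q r : Fin 2 → ℤ,
      (E r 0 + E r 1) * (E q 0 * E p 1 - E q 1 * E p 0) + (E p 0 + E p 1) * (E r 0 * E q 1 - E r 1 * E q 0) +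
        (E q 0 + E q 1) * (E p 0 * E r 1 - E p 1 * E r 0) = 0 := by
    intro p q r; ring
  -- non-zero generators
  set T' := T.filter (fun g => g ≠ 0) with hT'
  have hT'ne : T'.Nonempty := by
    by_contra hne
    rw [Finset.not_nonempty_iff_eq_empty] at hne
    have hP0 : ∀ p ∈ P, p = 0 := by
      intro p hp
      rw [← hT] at hp
      induction hp using AddSubmonoid.closure_induction with
      | mem z hz =>
        by_contra hz0
        have : z ∈ T' := Finset.mem_filter.2 ⟨hz, hz0⟩
        rw [hne] at this; simp at this
      | zero => rfl
      | add y z _ _ hy hz => rw [hy, hz, add_zero]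
    have htop : (Pi.single 0 1 : Fin 2 → ℤ) ∈ Submodule.span ℤ (P : Set (Fin 2 → ℤ)) := by
      rw [hspan]; exact Submodule.mem_top
    have hbot : Submodule.span ℤ (P : Set (Fin 2 → ℤ)) ≤ ⊥ := by
      rw [Submodule.span_le]; intro p hp; exact hP0 p hp
    have := hbot htop
    rw [Submodule.mem_bot] at this
    simpa using congr_fun this 0
  -- extremal generators: maximal and minimal slope `E₁ / λ`
  obtain ⟨u, huT', humax⟩ := Finset.exists_max_image T'
    (fun g => (E g 1 : ℚ) / ((E g 0 : ℚ) + E g 1)) hT'ne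
  obtain ⟨u', hu'T', hu'min⟩ := Finset.exists_min_image T'
    (fun g => (E g 1 : ℚ) / ((E g 0 : ℚ) + E g 1)) hT'ne
  have huT : u ∈ T := (Finset.mem_filter.1 huT').1
  have hu0 : u ≠ 0 := (Finset.mem_filter.1 huT').2
  have hu'T : u' ∈ T := (Finset.mem_filter.1 hu'T').1
  have hu'0 : u' ≠ 0 := (Finset.mem_filter.1 hu'T').2
  have huP : u ∈ P := hTP u huT
  have hu'P : u' ∈ P := hTP u' hu'T
  -- slope comparison ⇒ sign of `D`
  have hslope : ∀ p q : Fin 2 → ℤ, p ∈ P → p ≠ 0 → q ∈ P → q ≠ 0 →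
      (E q 1 : ℚ) / ((E q 0 : ℚ) + E q 1) ≤ (E p 1 : ℚ) / ((E p 0 : ℚ) + E p 1) →
      0 ≤ E q 0 * E p 1 - E q 1 * E p 0 := by
    intro p q hp hp0 hq hq0 h
    have hlp : (0 : ℚ) < (E p 0 : ℚ) + E p 1 := by exact_mod_cast hlam p hp hp0
    have hlq : (0 : ℚ) < (E q 0 : ℚ) + E q 1 := by exact_mod_cast hlam q hq hq0
    rw [div_le_iff₀ hlq, div_mul_eq_mul_div, le_div_iff₀ hlp] at h
    have h' : E q 1 * (E p 0 + E p 1) ≤ E p 1 * (E q 0 + E q 1) := by exact_mod_cast h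
    nlinarith [h']
  -- `D(u, g) ≥ 0` and `D(g, u') ≥ 0` on generators, hence on `P`
  have hDu : ∀ p ∈ P, 0 ≤ E p 0 * E u 1 - E p 1 * E u 0 := by
    intro p hp
    rw [← hT] at hp
    induction hp using AddSubmonoid.closure_induction with
    | mem z hz =>
      by_cases hz0 : z = 0
      · subst hz0; simp
      · exact hslope u z huP hu0 (hTP z hz) hz0 (humax z (Finset.mem_filter.2 ⟨hz, hz0⟩))
    | zero => simp
    | add y z _ _ hy hz => rw [hDadd]; exact add_nonneg hy hz
  have hDu' : ∀ p ∈ P, 0 ≤ E u' 0 * E p 1 - E u' 1 * E p 0 := by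
    intro p hp
    rw [← hT] at hp
    induction hp using AddSubmonoid.closure_induction with
    | mem z hz =>
      by_cases hz0 : z = 0
      · subst hz0; simp
      · exact hslope z u' (hTP z hz) hz0 hu'P hu'0 (hu'min z (Finset.mem_filter.2 ⟨hz, hz0⟩))
    | zero => simp
    | add y z _ _ hy hz => rw [hDadd']; exact add_nonneg hy hz
  -- `D` extends additively to all of `ℤ²`; vanishing on `P` means vanishing everywhere
  have hspanD : ∀ {w : Fin 2 → ℤ}, (∀ p ∈ P, E p 0 * E w 1 - E p 1 * E w 0 = 0) →
      ∀ x : Fin 2 → ℤ, E x 0 * E w 1 - E x 1 * E w 0 = 0 := by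
    intro w hw x
    have hx : x ∈ Submodule.span ℤ (P : Set (Fin 2 → ℤ)) := by rw [hspan]; exact Submodule.mem_top
    induction hx using Submodule.span_induction with
    | mem z hz => exact hw z hz
    | zero => simp
    | add y z _ _ hy hz => rw [hDadd, hy, hz, add_zero]
    | smul c y _ hy =>
      rw [map_zsmul]; simp only [Pi.smul_apply, smul_eq_mul]
      have : c * (E y 0 * E w 1 - E y 1 * E w 0) = 0 := by rw [hy, mul_zero]
      linear_combination this
  -- `D(u, u') > 0`
  have hDuu' : 0 < E u' 0 * E u 1 - E u' 1 * E u 0 := by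
    rcases (hDu u' hu'P).lt_or_eq with h | h
    · exact h
    · exfalso
      -- then `D(u, g) = 0` for every generator, so `D(u, ·) = 0` and `u = 0`
      have hgen0 : ∀ p ∈ P, E p 0 * E u 1 - E p 1 * E u 0 = 0 := by
        intro p hp
        rw [← hT] at hp
        induction hp using AddSubmonoid.closure_induction with
        | mem z hz =>
          by_cases hz0 : z = 0
          · subst hz0; simp
          · have hzP := hTP z hz
            have i3 := h3 u z u'
            have a1 := hDu z hzP
            have a2 := hDu' z hzP
            have l1 := hlam u' hu'P hu'0
            have l2 := hlam u huP hu0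
            have l3 := (hlam z hzP hz0).le
            have e0 : E u 0 * E u' 1 - E u 1 * E u' 0 = 0 := by linear_combination h
            nlinarith [mul_nonneg l1.le a1, mul_nonneg l2.le a2]
        | zero => simp
        | add y z _ _ hy hz => rw [hDadd, hy, hz, add_zero]
      exact hu0 (eq_zero_of_forall_cross_map E hEinj (hspanD hgen0))
  -- make `u` primitive and extend to a basis `(u₁, e₀)`
  obtain ⟨g, u₁, e₀, hg, hgu, hcr⟩ := exists_primitive hu0
  have hu₁P : u₁ ∈ P := hsat u₁ g hg (by rw [← natCast_zsmul, ← hgu]; exact huP)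
  have hEu : ∀ i, E u i = (g : ℤ) * E u₁ i := by
    intro i; rw [hgu, map_zsmul]; simp
  have hDu₁ : ∀ p ∈ P, 0 ≤ E p 0 * E u₁ 1 - E p 1 * E u₁ 0 := by
    intro p hp
    have h1 := hDu p hp
    rw [hEu 0, hEu 1] at h1
    have hg' : (0 : ℤ) < g := by exact_mod_cast hg
    have e1 : E p 0 * (↑g * E u₁ 1) - E p 1 * (↑g * E u₁ 0) = ↑g * (E p 0 * E u₁ 1 - E p 1 * E u₁ 0) := by ring
    rw [e1] at h1
    nlinarith [h1, hg']
  have hDu₁u' : 0 < E u' 0 * E u₁ 1 - E u' 1 * E u₁ 0 := by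
    have h1 := hDuu'
    rw [hEu 0, hEu 1] at h1
    have hg' : (0 : ℤ) < g := by exact_mod_cast hg
    nlinarith [h1, hg', hDu₁ u' hu'P]
  have hu₁0 : u₁ ≠ 0 := by
    rintro rfl; rw [smul_zero] at hgu; exact hu0 hgu
  obtain ⟨hind₀, hspan₀⟩ := basis_of_cross_eq_one hcr
  -- orient `e₀` so that `δ = D(u₁, e) > 0`
  obtain ⟨e₁, hind₁, hspan₁, hδ⟩ : ∃ e₁ : Fin 2 → ℤ, (∀ m l : ℤ, m • u₁ + l • e₁ = 0 → m = 0 ∧ l = 0) ∧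
      (∀ w : Fin 2 → ℤ, ∃ m l : ℤ, w = m • u₁ + l • e₁) ∧ 0 < E e₁ 0 * E u₁ 1 - E e₁ 1 * E u₁ 0 := by
    have hδ0 : E e₀ 0 * E u₁ 1 - E e₀ 1 * E u₁ 0 ≠ 0 := by
      intro h0
      -- `D(u₁, ·)` vanishes on the basis `(u₁, e₀)`, hence everywhere
      have hall : ∀ x : Fin 2 → ℤ, E x 0 * E u₁ 1 - E x 1 * E u₁ 0 = 0 := by
        intro x
        obtain ⟨m, l, rfl⟩ := hspan₀ x
        rw [map_add, map_zsmul, map_zsmul]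
        simp only [Pi.add_apply, Pi.smul_apply, smul_eq_mul]
        linear_combination l * h0
      exact hu₁0 (eq_zero_of_forall_cross_map E hEinj hall)
    rcases hδ0.lt_or_gt with hneg | hpos
    · refine ⟨-e₀, fun m l h => ?_, fun w => ?_, ?_⟩
      · have := hind₀ m (-l) (by rw [← h]; module); omega
      · obtain ⟨m, l, rfl⟩ := hspan₀ w; exact ⟨m, -l, by module⟩
      · rw [map_neg]; simp only [Pi.neg_apply]; linarith
    · exact ⟨e₀, hind₀, hspan₀, hpos⟩
  -- coordinates of `u'`
  obtain ⟨m', l', hu'eq⟩ := hspan₁ u'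
  have hD1 : ∀ m l : ℤ, E (m • u₁ + l • e₁) 0 * E u₁ 1 - E (m • u₁ + l • e₁) 1 * E u₁ 0 =
      l * (E e₁ 0 * E u₁ 1 - E e₁ 1 * E u₁ 0) := by
    intro m l
    simp only [map_add, map_zsmul, Pi.add_apply, Pi.smul_apply, smul_eq_mul]
    ring
  have hD2 : ∀ m l : ℤ, E u' 0 * E (m • u₁ + l • e₁) 1 - E u' 1 * E (m • u₁ + l • e₁) 0 =
      (m * l' - l * m') * (E e₁ 0 * E u₁ 1 - E e₁ 1 * E u₁ 0) := by
    intro m l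
    rw [hu'eq]
    simp only [map_add, map_zsmul, Pi.add_apply, Pi.smul_apply, smul_eq_mul]
    ring
  have hl' : 0 < l' := by
    have h1 := hDu₁u'
    rw [hu'eq, hD1] at h1
    nlinarith [hδ]
  -- membership in `P` in the coordinates `(u₁, e₁)`
  have hmem : ∀ m l : ℤ, m • u₁ + l • e₁ ∈ P ↔ 0 ≤ l ∧ m' * l ≤ l' * m := by
    intro m l
    constructor
    · intro hx
      have h1 := hDu₁ _ hx
      have h2 := hDu' _ hx
      rw [hD1] at h1
      rw [hD2] at h2
      constructor
      · nlinarith [hδ]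
      · nlinarith [hδ]
    · rintro ⟨hl, hml⟩
      apply hsat _ l'.toNat (by omega)
      have e1 : l'.toNat • (m • u₁ + l • e₁) = (l' * m - m' * l).toNat • u₁ + l.toNat • u' := by
        rw [← natCast_zsmul, ← natCast_zsmul u₁, ← natCast_zsmul u', Int.toNat_of_nonneg hl'.le,
          Int.toNat_of_nonneg (by linarith : 0 ≤ l' * m - m' * l), Int.toNat_of_nonneg hl, hu'eq]
        module
      rw [e1]
      exact P.add_mem (P.nsmul_mem hu₁P _) (P.nsmul_mem hu'P _)
  -- normalise `a = m' mod l'` by shifting `e` along `u₁`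
  set t := m' / l' with ht
  set a := m' % l' with ha
  have hat : a + l' * t = m' := Int.emod_add_mul_ediv m' l'
  have ha0 : 0 ≤ a := Int.emod_nonneg m' (by omega)
  have hal : a < l' := Int.emod_lt_of_pos m' hl'
  refine ⟨u₁, e₁ + t • u₁, l'.toNat, a.toNat, by omega, fun m l h => ?_, fun w => ?_, fun w => ?_⟩
  · have := hind₁ (m + l * t) l (by rw [← h]; module)
    constructor
    · have hl0 : l = 0 := this.2
      rw [hl0, zero_mul, add_zero] at this; exact this.1
    · exact this.2
  · obtain ⟨m, l, rfl⟩ := hspan₁ w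
    exact ⟨m - l * t, l, by module⟩
  · rw [Int.toNat_of_nonneg hl'.le, Int.toNat_of_nonneg ha0]
    constructor
    · intro hw
      obtain ⟨m, l, rfl⟩ := hspan₁ w
      obtain ⟨hl, hml⟩ := (hmem m l).1 hw
      refine ⟨m - l * t, l, hl, ?_, by module⟩
      rw [← hat] at hml
      nlinarith [hml]
    · rintro ⟨m, l, hl, hml, rfl⟩
      rw [show m • u₁ + l • (e₁ + t • u₁) = (m + l * t) • u₁ + l • e₁ by module]
      refine (hmem _ _).2 ⟨hl, ?_⟩
      rw [← hat]
      nlinarith [hml]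

end Summit.ResolutionOfSingularities.ResolutionOfSingularities.Theorems.FRationalResolution.ConeNormalForm
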